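import Mathlib
import Summits.NavierStokesRegularity.NavierStokesRegularity.Theorems.SubOnsagerCeilingDefs
import Summits.NavierStokesRegularity.NavierStokesRegularity.Theorems.SubOnsagerCeilingKPEntropyCurrency

/-!
# An `L^p` Kolmogorov-entropy ceiling along the solutions of a table IS the registered shell barrier of that table
# (helper file for the crux `SubOnsagerCeiling.ForwardTailCeilingKP`, stmt-NavierStokesRegularity-27057, `--supports`;
# hand leafhand-ns-subonsagerceiling-4 gen 10)

The registered stubs of the three items of the route's tail-ceiling family are, per table `α` and scale ratio `b = 1+ε₀`,
ν-UNIFORM WEIGHTED SHELL BARRIERS: `Theorems.SubOnsagerCeiling.ShellBarrierAt R ε₀ α` (verbatim the body of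
`Sig.stub_barrierLargeRatio` / `Sig.stub_barrierSmallRatio` of item 25507, file `Theorems/SubOnsagerCeilingDefs.lean`), which the
LEAD skeleton of item 27057 (`Cruxes/ForwardTailCeilingKP/Lines/kp_shell_barrier.lean`) turns into the crux body per table through
`ceilingAt_of_shellBarrier` and `fwdCeilingKPAt_of_ceilingAt`.  Hand leafhand-4-g6 proposed to attack the barrier in the SUM
currency of the Kolmogorov entropies `S_p(t) = Σ_k b^{(5/3)(p-1)k} E_k(t)^p`, `E_k = Σ_i ½X_{i,k}²` (abstract exchange rate:
`Theorems/SubOnsagerCeilingKPEntropyCurrency.lean`, p832670).  This file closes the TRANSFER in the registered currency, for every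
table and every ratio at once:

* `SubOnsagerCeiling.shellBarrierAt_of_entropyCeiling` — if `p > 5/2` and, along every honest non-negative `ν`-viscous solution of
  the table `α` at ratio `1+ε₀` from every one-shell datum (the hypothesis list of `ShellBarrierAt`, verbatim), every partial sum of
  `S_p(t)` is at most `C · E₀^p` (`C ≥ 0`, chosen before `ν`), then `ShellBarrierAt R ε₀ α` holds with
  `θ = θ_p := (5/6)(1 − 1/p) > 1/2` and `D = C^{1/p}` (one term of the sum, `p`-th root: `kpEntropy_shell_le`).

So an entropy ceiling with ANY `p ∈ (5/2, ∞)` and ANY constant is, by name, a sufficient condition for the stub bodies of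
items 25507 / 26608 / 27057 at that table and ratio.  WHAT THE NUMBERS SAY (this hand's inviscid front/wake integrator
`num/entp.c`, evidence memo ENTROPY-NETWORKS-leafhand4-g10.md on item 27057; MODEL numerics, not a proof): (i) Katz–Pavlović
chain, datum `e₀`, `b ∈ {1.05, 1.10, 1.14, 2}`: `sup_t S_p(t)/S_p(0) = 1` for every `p ≤ 4` (front exponents re-measured
`θ_f(1.10) = 0.6035`, `θ_f(1.14) = 0.630`); (ii) the measured worst four-mode network of the stubs (the reach pipeline of
`Theorems/SubOnsagerCeilingKPReachPipelineWitness.lean`; `θ_f = 0.554 / 0.642 / 0.833` at `b = 1.14 / 1.3 / 2`, every datum):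
with datum `e₀`, `sup_t S_p/S_p(0) = 1` for `p ≤ 3` while the front makes `S_p` grow without bound for `p ≥ 3.5` at `b = 1.14`
(`×3.6` at `p = 3.5`, `×21` at `p = 4` within 60 shells); with the datum on the return mode `e₃` the supremum is `1.05 / 1.30 /
1.42` (`p = 3`, `b = 1.14 / 1.3 / 2`), attained while the front sits at shells `3–5` (shell-1 pile-up `E₁ ≤ 0.88 / 0.81 / 0.51·E₀`).
Reading: the exponent window compatible with every measured front is `p ∈ (5/2, ≈2.98)`, i.e. `θ_p ∈ (1/2, 0.554)`, and the
constant `C = C_p(α, b)` of this file's hypothesis cannot be taken `= 1` for networks — the target is a BOUNDEDNESS statement, not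
a monotonicity-from-`t = 0` statement.
HONEST FRAMING: bookkeeping about Tao-type MODEL lattice ODEs (route SubOnsagerCeiling, rung TL-M2Break); the entropy ceiling
itself is NOT proved for any table here; no stub, crux or summit is proved and nothing in this file bears on Navier–Stokes
regularity. [cite: Tao2016AveragedNS, §4 (4.13)]
-/

noncomputable section

-- the sub-problem namespace `NavierStokesRegularity.NavierStokesRegularity` is the tree's layout (D-0017)
set_option linter.dupNamespace false

namespace Summit.NavierStokesRegularity.NavierStokesRegularity.Theorems.SubOnsagerCeiling

open Set Finset
open Summit.NavierStokesRegularity.NavierStokesRegularity.Theorems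

/-- **Entropy ceiling ⇒ registered shell barrier, per table and ratio.** Let `0 < ε₀`, `5/2 < p`, `0 ≤ C`. If along every
honest non-negative `ν`-viscous solution `X` of the table `α` at scale ratio `1+ε₀` from every one-shell datum `X₀` (hypotheses
verbatim those of `ShellBarrierAt`) the partial sums of the `p`-th Kolmogorov entropy are bounded before `ν`,
`Σ_{k ≤ N} (1+ε₀)^{(5/3)(p-1)k} · (Σ_i ½X_{i,k}(t)²)^p ≤ C · E₀^p` for all `t ∈ [0,s]` and all `N`, then
`ShellBarrierAt R ε₀ α` holds (with `θ = (5/6)(1 − 1/p) > 1/2`, `D = C^{1/p}`): each term of the sum is at most `C·E₀^p`, and its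
`p`-th root is the weighted shell energy (`kpEntropy_shell_le`), which dominates every single mode of the shell. [this file] -/
theorem shellBarrierAt_of_entropyCeiling {R ε₀ p C : ℝ} (hε : 0 < ε₀) (hp : 5 / 2 < p) (hC : 0 ≤ C)
    {α : Fin 4 → Fin 4 → Fin 4 → ℤ × ℤ × ℤ → ℝ}
    (hS : ∀ ν : ℝ, 0 < ν → ∀ (X₀ : Fin 4 → ℝ) (s : ℝ), 0 < s → ∀ X : Fin 4 → ℤ → ℝ → ℝ,
      (∀ (i : Fin 4) (k : ℤ), X i k 0 = if k = 0 then X₀ i else 0) →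
      (∀ (i : Fin 4) (k : ℤ), k < 0 → ∀ t : ℝ, X i k t = 0) →
      (∃ M : ℝ, ∀ (t : ℝ) (i : Fin 4) (k : ℤ), (1 + (1 + ε₀) ^ ((10 : ℝ) * k)) * |X i k t| ≤ M) →
      (∀ (i : Fin 4) (k : ℤ), Continuous (X i k)) →
      (∀ (i : Fin 4) (k : ℤ), ∀ t ∈ Set.Icc (0 : ℝ) s, HasDerivWithinAt (X i k)
        (Literature.Analysis.FluidPDE.TaoCascade.quadTerm ε₀ α X i k t - ν * (1 + ε₀) ^ ((2 : ℝ) * k) * X i k t)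
        (Set.Icc (0 : ℝ) s) t) →
      (∀ t ∈ Set.Icc (0 : ℝ) s, ∀ (i : Fin 4) (k : ℤ), 1 ≤ k → 0 ≤ X i k t) →
      ∀ t ∈ Set.Icc (0 : ℝ) s, ∀ N : ℕ,
        ∑ k ∈ Finset.range (N + 1),
            (1 + ε₀) ^ ((5 : ℝ) / 3 * (p - 1) * (k : ℕ)) * (∑ i : Fin 4, (1 / 2 : ℝ) * X i (k : ℤ) t ^ 2) ^ p ≤
          C * (∑ j : Fin 4, (1 / 2 : ℝ) * X₀ j ^ 2) ^ p) :
    ShellBarrierAt R ε₀ α := by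
  intro _hT _hO
  have hp0 : 0 < p := by linarith
  have hp1 : 1 ≤ p := by linarith
  have hb : (0 : ℝ) < 1 + ε₀ := by linarith
  -- the exponent `θ_p = (5/6)(1 - 1/p)` is super-critical exactly because `p > 5/2`
  have hθ : (1 : ℝ) / 2 < 5 / 6 * (1 - 1 / p) := ((kpEntropy_exponent hp0).1).2 hp
  refine ⟨5 / 6 * (1 - 1 / p), hθ, C ^ (1 / p), Real.rpow_nonneg hC _, ?_⟩
  intro ν hν X₀ s hs X hdat hvan hbd hcont hode hnn t ht i k
  set E₀ : ℝ := ∑ j : Fin 4, (1 / 2 : ℝ) * X₀ j ^ 2 with hE₀def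
  have hE₀ : 0 ≤ E₀ := Finset.sum_nonneg fun j _ => by positivity
  -- the shell energy at shell `k` and the `k`-th entropy term
  set Ek : ℝ := ∑ i : Fin 4, (1 / 2 : ℝ) * X i (k : ℤ) t ^ 2 with hEkdef
  have hEk : 0 ≤ Ek := Finset.sum_nonneg fun j _ => by positivity
  have hsum := hS ν hν X₀ s hs X hdat hvan hbd hcont hode hnn t ht k
  -- one term of a sum of non-negative terms is at most the sum
  have hterm : (1 + ε₀) ^ ((5 : ℝ) / 3 * (p - 1) * (k : ℕ)) * Ek ^ p ≤ C * E₀ ^ p := by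
    refine le_trans ?_ hsum
    have hmem : k ∈ Finset.range (k + 1) := Finset.mem_range.2 (Nat.lt_succ_self k)
    refine Finset.single_le_sum (f := fun k' : ℕ =>
      (1 + ε₀) ^ ((5 : ℝ) / 3 * (p - 1) * (k' : ℕ)) * (∑ i : Fin 4, (1 / 2 : ℝ) * X i (k' : ℤ) t ^ 2) ^ p)
      (fun k' _ => ?_) hmem
    exact mul_nonneg (Real.rpow_nonneg hb.le _)
      (Real.rpow_nonneg (Finset.sum_nonneg fun j _ => by positivity) _)
  -- `p`-th root: the weighted shell energy is at most `(C E₀^p)^{1/p} = C^{1/p} E₀`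
  have hroot := kpEntropy_shell_le (n := k) hb hp1 hEk hterm
  have hsplit : (C * E₀ ^ p) ^ (1 / p) = C ^ (1 / p) * E₀ := by
    rw [Real.mul_rpow hC (Real.rpow_nonneg hE₀ p), ← Real.rpow_mul hE₀]
    have h2 : p * (1 / p) = 1 := by field_simp
    rw [h2, Real.rpow_one]
  rw [hsplit] at hroot
  -- the single mode `i` carries at most the shell energy
  have hmode : (1 / 2 : ℝ) * X i (k : ℤ) t ^ 2 ≤ Ek := by
    rw [hEkdef]
    exact Finset.single_le_sum (f := fun i' : Fin 4 => (1 / 2 : ℝ) * X i' (k : ℤ) t ^ 2)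
      (fun i' _ => by positivity) (Finset.mem_univ i)
  have hexp : (2 : ℝ) * (5 / 6 * (1 - 1 / p)) * (k : ℝ) = (5 : ℝ) / 3 * (1 - 1 / p) * (k : ℕ) := by
    ring
  have hw : 0 ≤ (1 + ε₀) ^ ((5 : ℝ) / 3 * (1 - 1 / p) * (k : ℕ)) := Real.rpow_nonneg hb.le _
  calc (1 + ε₀) ^ (2 * (5 / 6 * (1 - 1 / p)) * (k : ℝ)) * ((1 / 2 : ℝ) * X i (k : ℤ) t ^ 2)
      = (1 + ε₀) ^ ((5 : ℝ) / 3 * (1 - 1 / p) * (k : ℕ)) * ((1 / 2 : ℝ) * X i (k : ℤ) t ^ 2) := by rw [hexp]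
    _ ≤ (1 + ε₀) ^ ((5 : ℝ) / 3 * (1 - 1 / p) * (k : ℕ)) * Ek := mul_le_mul_of_nonneg_left hmode hw
    _ ≤ C ^ (1 / p) * E₀ := hroot
    _ = C ^ (1 / p) * (∑ j : Fin 4, (1 / 2 : ℝ) * X₀ j ^ 2) := by rw [hE₀def]

end Summit.NavierStokesRegularity.NavierStokesRegularity.Theorems.SubOnsagerCeiling

end
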